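import Mathlib
import Summits.KontsevichZagierPeriods.Zeta5Search.FamilyCellAAtlasNotMin
import HarnessLib

/-!
# ζ(5) search — the CLASS ATLAS of the consecutive family `b = n·(3t+8; t+6,…,t)` at the primes `(t+3)n < 2p < (t+4)n` (family cell D)

Cell `pub-zeta5` (HONEST FRAMING: systematic search; no irrationality claim unless certified), P1 prover seat
generation 6; the combinatorial half of the Lean proof of census g11's `CellAtlas.FamilyCellD` (`t ≥ 10`; `t = 11` is the
record cell D of `RecordCellDAtlas`).  Write `m = tn`, `N = b₀ = 3m + 8n`.  For `m + 3n < 2p < m + 4n` every residue class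
modulo `p` in `[0, N]` has five or six points; in the coordinate `w·n = x + p − m` of the second point and the excess
`2εn = 2p − m − 3n ∈ (0, n)` the type of the class of `x < p` is read off a bounded window (gen-2 g9's face certificate,
REPORT-gen2-g9 §8, claims D1–D6, here for all `n` and all `t ≥ 10` by hand):

* the depth table beyond depth 4 (`depF_lower7`, `depF_upper7`, `depF_well`), the classes (`classSet_bFamD`);
* the MINIMAL multipole classes (class exponent `−8`): `FMinT1` (type `(1,−1,−6,−3,1)`), `FMinS` (palindromic `(1,−2,−6,−2,1)`,
  not self-conjugate), `FMinT2` (type `(1,−3,−6,−1,1)` = conjugates of `FMinT1` under `x ↦ N − (x+4p)`) and — new from `t = 12`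
  on — `FMinP` (the six-point palindrome `(1,1,−6,−6,1,1)`, not self-conjugate, conjugation `x ↦ N − (x+5p)`), with their net
  exponents for `b` AND `b + e₇` and the centre-freeness;
* (part 2, `FamilyCellDAtlasNotMin.lean`) every OTHER class has class exponent `≥ −7`.
Exact arithmetic, linear in `(m, n, x, p)`; cross-checked against an independent partial-fraction kernel at 8 instances
`t ∈ {10,12,13,14,15,17}` (`code/p1/g6/famD_check.py`).  Nothing about irrationality.
-/

open Finset

namespace Summit.KontsevichZagierPeriods.Zeta5Search.CellD

open Summit.KontsevichZagierPeriods.Zeta5Search.ClusterValuation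
open Summit.KontsevichZagierPeriods.Zeta5Search.CasoratianValuation (shift)
open Summit.KontsevichZagierPeriods.Zeta5Search.BigPrime (block shift_zero)
open Summit.KontsevichZagierPeriods.Zeta5Search.CellAtlas (bFam)
open Summit.KontsevichZagierPeriods.Zeta5Search.CellA

/-! ### §1 The depth table of the family beyond depth four -/

/-- Lower side: `k` blocks contain `q ∈ [m + (k−1)n, m + kn)` for `1 ≤ k ≤ 6` (`m ≥ 3n`). -/
theorem depF_lower7 {t n q k : ℕ} (hk1 : 1 ≤ k) (hk : k ≤ 6) (h3 : 3 * n ≤ t * n) (h1 : t * n + (k - 1) * n ≤ q)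
    (h2 : q < t * n + k * n) : depF t n q = k := by
  interval_cases k <;> unfold depF <;> split_ifs <;> omega

/-- Upper side: `k` blocks contain `q ∈ (2m + (8−k)n, 2m + (9−k)n]` for `1 ≤ k ≤ 6` (`m ≥ 3n`). -/
theorem depF_upper7 {t n q k : ℕ} (hk1 : 1 ≤ k) (hk : k ≤ 6) (h3 : 3 * n ≤ t * n) (h1 : 2 * (t * n) + (8 - k) * n < q)
    (h2 : q ≤ 2 * (t * n) + (9 - k) * n) : depF t n q = k := by
  interval_cases k <;> unfold depF <;> split_ifs <;> omega

/-- The deep well: all seven blocks contain `q ∈ [m + 6n, 2m + 2n]`. -/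
theorem depF_well {t n q : ℕ} (h1 : t * n + 6 * n ≤ q) (h2 : q ≤ 2 * (t * n) + 2 * n) : depF t n q = 7 := by
  unfold depF; split_ifs <;> omega

/-- The net exponent at the even centre `2q = N` (`m ≥ 4n`): `1 − 7 + 1 = −5`. -/
theorem netExpF_centre {t n q : ℕ} (h4 : 4 * n ≤ t * n) (hc : 2 * q = 3 * (t * n) + 8 * n) : netExp (bFam t n) q = -5 := by
  rw [netExp_bFam, depF_well (by omega) (by omega), if_pos hc]; norm_num

/-! ### §2 The residue classes for `m + 3n < 2p < m + 4n` -/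

section Classes

variable {t n p : ℕ} (ht : 10 ≤ t) (hp : t * n + 3 * n < 2 * p) (hp' : 2 * p < t * n + 4 * n)

include ht hp hp' in
/-- **The class of `x < p`**: `{x, x+p, …, x+5p}` if `x + 5p ≤ N`, else `{x, x+p, …, x+4p}`. -/
theorem classSet_bFamD {x : ℕ} (hx : x < p) :
    classSet (bFam t n) p x = if x + 5 * p ≤ 3 * (t * n) + 8 * n then {x, x + p, x + 2 * p, x + 3 * p, x + 4 * p, x + 5 * p}
      else {x, x + p, x + 2 * p, x + 3 * p, x + 4 * p} := by
  have h10 : 10 * n ≤ t * n := Nat.mul_le_mul_right n ht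
  ext s
  rw [mem_classSet_iff, bFam_zero_toNat]
  have key : (s ≤ 3 * (t * n) + 8 * n ∧ (p : ℤ) ∣ (s : ℤ) - x) ↔
      (s = x ∨ s = x + p ∨ s = x + 2 * p ∨ s = x + 3 * p ∨ s = x + 4 * p ∨
        (s = x + 5 * p ∧ x + 5 * p ≤ 3 * (t * n) + 8 * n)) := by
    constructor
    · rintro ⟨hs, k, hk⟩
      have hk0 : 0 ≤ k := by
        by_contra hneg
        push Not at hneg
        have : (p : ℤ) * k ≤ (p : ℤ) * (-1) := mul_le_mul_of_nonneg_left (by omega) (by omega)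
        omega
      have hk6 : k < 6 := by
        by_contra hge
        push Not at hge
        have : (p : ℤ) * 6 ≤ (p : ℤ) * k := mul_le_mul_of_nonneg_left hge (by omega)
        have h' : ((s : ℕ) : ℤ) ≤ ((3 * (t * n) + 8 * n : ℕ) : ℤ) := by exact_mod_cast hs
        have hp2 : ((t * n + 3 * n : ℕ) : ℤ) < ((2 * p : ℕ) : ℤ) := by exact_mod_cast hp
        push_cast at h' hp2
        omega
      interval_cases k <;> omega
    · rintro (rfl | rfl | rfl | rfl | rfl | ⟨rfl, h⟩)
      · exact ⟨by omega, 0, by ring⟩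
      · exact ⟨by omega, 1, by push_cast; ring⟩
      · exact ⟨by omega, 2, by push_cast; ring⟩
      · exact ⟨by omega, 3, by push_cast; ring⟩
      · exact ⟨by omega, 4, by push_cast; ring⟩
      · exact ⟨h, 5, by push_cast; ring⟩
  rw [key]
  split_ifs with h6
  · simp only [mem_insert, mem_singleton]; tauto
  · simp only [mem_insert, mem_singleton]
    constructor
    · rintro (h | h | h | h | h | ⟨h, h'⟩)
      · exact Or.inl h
      · exact Or.inr (Or.inl h)
      · exact Or.inr (Or.inr (Or.inl h))
      · exact Or.inr (Or.inr (Or.inr (Or.inl h)))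
      · exact Or.inr (Or.inr (Or.inr (Or.inr h)))
      · exact absurd h' h6
    · rintro (h | h | h | h | h)
      · exact Or.inl h
      · exact Or.inr (Or.inl h)
      · exact Or.inr (Or.inr (Or.inl h))
      · exact Or.inr (Or.inr (Or.inr (Or.inl h)))
      · exact Or.inr (Or.inr (Or.inr (Or.inr (Or.inl h))))

omit hp' in
/-- The sum of a function over a five-point class. -/
theorem sum_five' {p x : ℕ} (hp0 : 0 < p) (f : ℕ → ℤ) :
    ∑ s ∈ ({x, x + p, x + 2 * p, x + 3 * p, x + 4 * p} : Finset ℕ), f s =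
      f x + f (x + p) + f (x + 2 * p) + f (x + 3 * p) + f (x + 4 * p) := by
  rw [sum_insert (by simp; omega), sum_insert (by simp; omega), sum_insert (by simp; omega), sum_pair (by omega)]
  ring

omit hp' in
/-- The sum of a function over a six-point class. -/
theorem sum_six' {p x : ℕ} (hp0 : 0 < p) (f : ℕ → ℤ) :
    ∑ s ∈ ({x, x + p, x + 2 * p, x + 3 * p, x + 4 * p, x + 5 * p} : Finset ℕ), f s =
      f x + f (x + p) + f (x + 2 * p) + f (x + 3 * p) + f (x + 4 * p) + f (x + 5 * p) := by
  rw [sum_insert (by simp; omega), sum_insert (by simp; omega), sum_insert (by simp; omega), sum_insert (by simp; omega),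
    sum_pair (by omega)]
  ring

include ht hp hp' in
/-- Five-point classes: the exponent sum is a lower bound for the class exponent. -/
theorem classExpF_ge_five {x : ℕ} (hx : x < p) (h6 : ¬ x + 5 * p ≤ 3 * (t * n) + 8 * n) :
    netExp (bFam t n) x + netExp (bFam t n) (x + p) + netExp (bFam t n) (x + 2 * p) + netExp (bFam t n) (x + 3 * p) +
      netExp (bFam t n) (x + 4 * p) ≤ classExp (bFam t n) p x := by
  refine le_trans (le_of_eq ?_) (classExp_ge_sum _ _ _)
  rw [classSet_bFamD ht hp hp' hx, if_neg h6, sum_five' (by omega)]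

include ht hp hp' in
/-- Six-point classes: the exponent sum is a lower bound for the class exponent. -/
theorem classExpF_ge_six {x : ℕ} (hx : x < p) (h6 : x + 5 * p ≤ 3 * (t * n) + 8 * n) :
    netExp (bFam t n) x + netExp (bFam t n) (x + p) + netExp (bFam t n) (x + 2 * p) + netExp (bFam t n) (x + 3 * p) +
      netExp (bFam t n) (x + 4 * p) + netExp (bFam t n) (x + 5 * p) ≤ classExp (bFam t n) p x := by
  refine le_trans (le_of_eq ?_) (classExp_ge_sum _ _ _)
  rw [classSet_bFamD ht hp hp' hx, if_pos h6, sum_six' (by omega)]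

include ht hp hp' in
/-- Six-point SELF-CONJUGATE classes (`2x + 5p = N`, odd `p`): the class exponent is the exponent sum plus the centre term `1`. -/
theorem classExpF_six_centre {x : ℕ} (hx : x < p) (hodd : ¬ 2 ∣ p) (hc : 2 * x + 5 * p = 3 * (t * n) + 8 * n) :
    classExp (bFam t n) p x = netExp (bFam t n) x + netExp (bFam t n) (x + p) + netExp (bFam t n) (x + 2 * p) +
      netExp (bFam t n) (x + 3 * p) + netExp (bFam t n) (x + 4 * p) + netExp (bFam t n) (x + 5 * p) + 1 := by
  have hcen : ¬ (2 : ℤ) ∣ bFam t n 0 ∧ CentreIn (bFam t n) p x := by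
    rw [CentreIn, bFam_val0]
    refine ⟨fun h2 => hodd ?_, ⟨-5, by push_cast; omega⟩⟩
    have h2' : (2 : ℤ) ∣ (p : ℤ) := by
      have e : ((3 * (t * n) + 8 * n : ℕ) : ℤ) = 2 * ((x : ℤ) + 2 * p) + p := by push_cast; omega
      rw [e] at h2
      exact (dvd_add_right (dvd_mul_right 2 _)).1 h2
    exact Int.natCast_dvd_natCast.1 h2'
  unfold classExp
  rw [if_pos hcen, classSet_bFamD ht hp hp' hx, if_pos (by omega), sum_six' (by omega)]

include ht hp hp' in
/-- **Centre-freeness**: a class `x < p` with `2x + 4p ≠ N` and `2x + 5p ≠ N` does not contain the centre residue. -/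
theorem not_centreInF {x : ℕ} (hx : x < p) (h4 : 2 * x + 4 * p ≠ 3 * (t * n) + 8 * n)
    (h5 : 2 * x + 5 * p ≠ 3 * (t * n) + 8 * n) : ¬ CentreIn (bFam t n) p x := by
  have h10 : 10 * n ≤ t * n := Nat.mul_le_mul_right n ht
  rintro ⟨k, hk⟩
  rw [bFam_val0] at hk
  push_cast at hk
  have hp2 : ((t * n + 3 * n : ℕ) : ℤ) < ((2 * p : ℕ) : ℤ) := by exact_mod_cast hp
  have hp3 : ((2 * p : ℕ) : ℤ) < ((t * n + 4 * n : ℕ) : ℤ) := by exact_mod_cast hp'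
  have h10' : ((10 * n : ℕ) : ℤ) ≤ ((t * n : ℕ) : ℤ) := by exact_mod_cast h10
  push_cast at hp2 hp3 h10'
  have hk1 : -6 < k := by
    by_contra hle
    push Not at hle
    have : (p : ℤ) * k ≤ (p : ℤ) * (-6) := mul_le_mul_of_nonneg_left hle (by omega)
    nlinarith
  have hk2 : k < -3 := by
    by_contra hge
    push Not at hge
    have : (p : ℤ) * (-3) ≤ (p : ℤ) * k := mul_le_mul_of_nonneg_left hge (by omega)
    nlinarith
  interval_cases k <;> omega

end Classes

/-! ### §3 The minimal multipole classes -/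

/-- Type `(1,−1,−6,−3,1)`: `m + n ≤ x+p`, `x+3p ≤ 2m + 5n`, no sixth point. -/
def FMinT1 (t n p : ℕ) : Finset ℕ :=
  (range p).filter fun x => t * n + n ≤ x + p ∧ x + 3 * p ≤ 2 * (t * n) + 5 * n ∧ 3 * (t * n) + 8 * n < x + 5 * p

/-- Type `(1,−2,−6,−2,1)`: `m + 2n ≤ x+p`, `x+3p ≤ 2m + 6n`, not self-conjugate (`2x + 4p ≠ N`). -/
def FMinS (t n p : ℕ) : Finset ℕ :=
  (range p).filter fun x => t * n + 2 * n ≤ x + p ∧ x + 3 * p ≤ 2 * (t * n) + 6 * n ∧ 2 * x + 4 * p ≠ 3 * (t * n) + 8 * n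

/-- Type `(1,−3,−6,−1,1)`: `m + 3n ≤ x+p`, `x+3p ≤ 2m + 7n`. -/
def FMinT2 (t n p : ℕ) : Finset ℕ := (range p).filter fun x => t * n + 3 * n ≤ x + p ∧ x + 3 * p ≤ 2 * (t * n) + 7 * n

/-- The six-point palindrome `(1,1,−6,−6,1,1)` (`t ≥ 12`): `m + 6n ≤ x+2p`, `x+3p ≤ 2m + 2n`, not self-conjugate
(`2x + 5p ≠ N`). -/
def FMinP (t n p : ℕ) : Finset ℕ :=
  (range p).filter fun x => t * n + 6 * n ≤ x + 2 * p ∧ x + 3 * p ≤ 2 * (t * n) + 2 * n ∧ 2 * x + 5 * p ≠ 3 * (t * n) + 8 * n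

/-- All minimal multipole classes of the family cell D. -/
def FMinAllD (t n p : ℕ) : Finset ℕ := FMinT1 t n p ∪ FMinS t n p ∪ FMinT2 t n p ∪ FMinP t n p

/-- Membership in `FMinT1`. -/
theorem mem_fminT1 {t n p x : ℕ} : x ∈ FMinT1 t n p ↔
    x < p ∧ t * n + n ≤ x + p ∧ x + 3 * p ≤ 2 * (t * n) + 5 * n ∧ 3 * (t * n) + 8 * n < x + 5 * p := by
  simp [FMinT1]

/-- Membership in `FMinS`. -/
theorem mem_fminS' {t n p x : ℕ} : x ∈ FMinS t n p ↔
    x < p ∧ t * n + 2 * n ≤ x + p ∧ x + 3 * p ≤ 2 * (t * n) + 6 * n ∧ 2 * x + 4 * p ≠ 3 * (t * n) + 8 * n := by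
  simp [FMinS]

/-- Membership in `FMinT2`. -/
theorem mem_fminT2 {t n p x : ℕ} : x ∈ FMinT2 t n p ↔ x < p ∧ t * n + 3 * n ≤ x + p ∧ x + 3 * p ≤ 2 * (t * n) + 7 * n := by
  simp [FMinT2]

/-- Membership in `FMinP`. -/
theorem mem_fminP {t n p x : ℕ} : x ∈ FMinP t n p ↔
    x < p ∧ t * n + 6 * n ≤ x + 2 * p ∧ x + 3 * p ≤ 2 * (t * n) + 2 * n ∧ 2 * x + 5 * p ≠ 3 * (t * n) + 8 * n := by
  simp [FMinP]

/-- `FMinAllD ⊆ range p`. -/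
theorem fminAllD_subset (t n p : ℕ) : FMinAllD t n p ⊆ range p := by
  intro x hx
  simp only [FMinAllD, mem_union, mem_fminT1, mem_fminS', mem_fminT2, mem_fminP] at hx
  rw [mem_range]
  rcases hx with ((h | h) | h) | h
  · exact h.1
  · exact h.1
  · exact h.1
  · exact h.1

/-- `FMinT1` and `FMinS` are disjoint. -/
theorem disjoint_fminT1_fminS (t n p : ℕ) : Disjoint (FMinT1 t n p) (FMinS t n p) := by
  rw [Finset.disjoint_left]
  intro x h1 h2
  rw [mem_fminT1] at h1; rw [mem_fminS'] at h2
  omega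

/-- `FMinT1 ∪ FMinS` and `FMinT2` are disjoint. -/
theorem disjoint_fminT1S_fminT2 (t n p : ℕ) : Disjoint (FMinT1 t n p ∪ FMinS t n p) (FMinT2 t n p) := by
  rw [Finset.disjoint_left]
  intro x h12 h3
  rw [mem_union, mem_fminT1, mem_fminS'] at h12; rw [mem_fminT2] at h3
  omega

/-- `FMinT1 ∪ FMinS ∪ FMinT2` and `FMinP` are disjoint. -/
theorem disjoint_fminT1ST2_fminP (t n p : ℕ) : Disjoint (FMinT1 t n p ∪ FMinS t n p ∪ FMinT2 t n p) (FMinP t n p) := by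
  rw [Finset.disjoint_left]
  intro x h123 h4
  rw [mem_union, mem_union, mem_fminT1, mem_fminS', mem_fminT2] at h123; rw [mem_fminP] at h4
  omega

section MinExps

variable {t n p : ℕ} (ht : 10 ≤ t) (hp : t * n + 3 * n < 2 * p) (hp' : 2 * p < t * n + 4 * n)

include ht hp hp' in
/-- Net exponents of a class of `FMinT1`: `(1,−1,−6,−3,1)`, also for `b + e₇`; five points; centre-free. -/
theorem netExp_fminT1 {x : ℕ} (hx : x ∈ FMinT1 t n p) :
    (netExp (bFam t n) x = 1 ∧ netExp (bFam t n) (x + p) = -1 ∧ netExp (bFam t n) (x + 2 * p) = -6 ∧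
      netExp (bFam t n) (x + 3 * p) = -3 ∧ netExp (bFam t n) (x + 4 * p) = 1) ∧
    (netExp (shift (bFam t n) 7) x = 1 ∧ netExp (shift (bFam t n) 7) (x + p) = -1 ∧
      netExp (shift (bFam t n) 7) (x + 2 * p) = -6 ∧ netExp (shift (bFam t n) 7) (x + 3 * p) = -3 ∧
      netExp (shift (bFam t n) 7) (x + 4 * p) = 1) ∧
    x < p ∧ x + 4 * p ≤ 3 * (t * n) + 8 * n ∧ 3 * (t * n) + 8 * n < x + 5 * p ∧
      2 * x + 4 * p ≠ 3 * (t * n) + 8 * n ∧ 2 * x + 5 * p ≠ 3 * (t * n) + 8 * n := by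
  have h10 : 10 * n ≤ t * n := Nat.mul_le_mul_right n ht
  rw [mem_fminT1] at hx
  obtain ⟨hxp, h12, h27, h41⟩ := hx
  have e0 : netExp (bFam t n) x = 1 := by
    rw [netExp_bFam_of_ne t n x (by omega), depF_low (by omega)]; norm_num
  have e1 : netExp (bFam t n) (x + p) = -1 := by
    rw [netExp_bFam_of_ne t n (x + p) (by omega), depF_lower7 (k := 2) (by norm_num) (by norm_num) (by omega) (by omega)
      (by omega)]; norm_num
  have e2 : netExp (bFam t n) (x + 2 * p) = -6 := by
    rw [netExp_bFam_of_ne t n (x + 2 * p) (by omega), depF_well (by omega) (by omega)]; norm_num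
  have e3 : netExp (bFam t n) (x + 3 * p) = -3 := by
    rw [netExp_bFam_of_ne t n (x + 3 * p) (by omega), depF_upper7 (k := 4) (by norm_num) (by norm_num) (by omega) (by omega)
      (by omega)]; norm_num
  have e4 : netExp (bFam t n) (x + 4 * p) = 1 := by
    rw [netExp_bFam_of_ne t n (x + 4 * p) (by omega), depF_high (by omega)]; norm_num
  refine ⟨⟨e0, e1, e2, e3, e4⟩, ⟨?_, ?_, ?_, ?_, ?_⟩, hxp, by omega, h41, by omega, by omega⟩
  · rw [netExp_shiftF7 t n x (by omega) (by omega), e0]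
  · rw [netExp_shiftF7 t n (x + p) (by omega) (by omega), e1]
  · rw [netExp_shiftF7 t n (x + 2 * p) (by omega) (by omega), e2]
  · rw [netExp_shiftF7 t n (x + 3 * p) (by omega) (by omega), e3]
  · rw [netExp_shiftF7 t n (x + 4 * p) (by omega) (by omega), e4]

include ht hp hp' in
/-- Net exponents of a class of `FMinS`: `(1,−2,−6,−2,1)`, also for `b + e₇`; five points; centre-free. -/
theorem netExp_fminSD {x : ℕ} (hx : x ∈ FMinS t n p) :
    (netExp (bFam t n) x = 1 ∧ netExp (bFam t n) (x + p) = -2 ∧ netExp (bFam t n) (x + 2 * p) = -6 ∧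
      netExp (bFam t n) (x + 3 * p) = -2 ∧ netExp (bFam t n) (x + 4 * p) = 1) ∧
    (netExp (shift (bFam t n) 7) x = 1 ∧ netExp (shift (bFam t n) 7) (x + p) = -2 ∧
      netExp (shift (bFam t n) 7) (x + 2 * p) = -6 ∧ netExp (shift (bFam t n) 7) (x + 3 * p) = -2 ∧
      netExp (shift (bFam t n) 7) (x + 4 * p) = 1) ∧
    x < p ∧ x + 4 * p ≤ 3 * (t * n) + 8 * n ∧ 3 * (t * n) + 8 * n < x + 5 * p ∧
      2 * x + 4 * p ≠ 3 * (t * n) + 8 * n ∧ 2 * x + 5 * p ≠ 3 * (t * n) + 8 * n := by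
  have h10 : 10 * n ≤ t * n := Nat.mul_le_mul_right n ht
  rw [mem_fminS'] at hx
  obtain ⟨hxp, h13, h28, hself⟩ := hx
  have e0 : netExp (bFam t n) x = 1 := by
    rw [netExp_bFam_of_ne t n x (by omega), depF_low (by omega)]; norm_num
  have e1 : netExp (bFam t n) (x + p) = -2 := by
    rw [netExp_bFam_of_ne t n (x + p) (by omega), depF_lower7 (k := 3) (by norm_num) (by norm_num) (by omega) (by omega)
      (by omega)]; norm_num
  have e2 : netExp (bFam t n) (x + 2 * p) = -6 := by
    rw [netExp_bFam_of_ne t n (x + 2 * p) (by omega), depF_well (by omega) (by omega)]; norm_num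
  have e3 : netExp (bFam t n) (x + 3 * p) = -2 := by
    rw [netExp_bFam_of_ne t n (x + 3 * p) (by omega), depF_upper7 (k := 3) (by norm_num) (by norm_num) (by omega) (by omega)
      (by omega)]; norm_num
  have e4 : netExp (bFam t n) (x + 4 * p) = 1 := by
    rw [netExp_bFam_of_ne t n (x + 4 * p) (by omega), depF_high (by omega)]; norm_num
  refine ⟨⟨e0, e1, e2, e3, e4⟩, ⟨?_, ?_, ?_, ?_, ?_⟩, hxp, by omega, by omega, hself, by omega⟩
  · rw [netExp_shiftF7 t n x (by omega) (by omega), e0]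
  · rw [netExp_shiftF7 t n (x + p) (by omega) (by omega), e1]
  · rw [netExp_shiftF7 t n (x + 2 * p) (by omega) (by omega), e2]
  · rw [netExp_shiftF7 t n (x + 3 * p) (by omega) (by omega), e3]
  · rw [netExp_shiftF7 t n (x + 4 * p) (by omega) (by omega), e4]

include ht hp hp' in
/-- Net exponents of a class of `FMinT2`: `(1,−3,−6,−1,1)`, also for `b + e₇`; five points; centre-free. -/
theorem netExp_fminT2 {x : ℕ} (hx : x ∈ FMinT2 t n p) :
    (netExp (bFam t n) x = 1 ∧ netExp (bFam t n) (x + p) = -3 ∧ netExp (bFam t n) (x + 2 * p) = -6 ∧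
      netExp (bFam t n) (x + 3 * p) = -1 ∧ netExp (bFam t n) (x + 4 * p) = 1) ∧
    (netExp (shift (bFam t n) 7) x = 1 ∧ netExp (shift (bFam t n) 7) (x + p) = -3 ∧
      netExp (shift (bFam t n) 7) (x + 2 * p) = -6 ∧ netExp (shift (bFam t n) 7) (x + 3 * p) = -1 ∧
      netExp (shift (bFam t n) 7) (x + 4 * p) = 1) ∧
    x < p ∧ x + 4 * p ≤ 3 * (t * n) + 8 * n ∧ 3 * (t * n) + 8 * n < x + 5 * p ∧
      2 * x + 4 * p ≠ 3 * (t * n) + 8 * n ∧ 2 * x + 5 * p ≠ 3 * (t * n) + 8 * n := by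
  have h10 : 10 * n ≤ t * n := Nat.mul_le_mul_right n ht
  rw [mem_fminT2] at hx
  obtain ⟨hxp, h14, h29⟩ := hx
  have e0 : netExp (bFam t n) x = 1 := by
    rw [netExp_bFam_of_ne t n x (by omega), depF_low (by omega)]; norm_num
  have e1 : netExp (bFam t n) (x + p) = -3 := by
    rw [netExp_bFam_of_ne t n (x + p) (by omega), depF_lower7 (k := 4) (by norm_num) (by norm_num) (by omega) (by omega)
      (by omega)]; norm_num
  have e2 : netExp (bFam t n) (x + 2 * p) = -6 := by
    rw [netExp_bFam_of_ne t n (x + 2 * p) (by omega), depF_well (by omega) (by omega)]; norm_num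
  have e3 : netExp (bFam t n) (x + 3 * p) = -1 := by
    rw [netExp_bFam_of_ne t n (x + 3 * p) (by omega), depF_upper7 (k := 2) (by norm_num) (by norm_num) (by omega) (by omega)
      (by omega)]; norm_num
  have e4 : netExp (bFam t n) (x + 4 * p) = 1 := by
    rw [netExp_bFam_of_ne t n (x + 4 * p) (by omega), depF_high (by omega)]; norm_num
  refine ⟨⟨e0, e1, e2, e3, e4⟩, ⟨?_, ?_, ?_, ?_, ?_⟩, hxp, by omega, by omega, by omega, by omega⟩
  · rw [netExp_shiftF7 t n x (by omega) (by omega), e0]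
  · rw [netExp_shiftF7 t n (x + p) (by omega) (by omega), e1]
  · rw [netExp_shiftF7 t n (x + 2 * p) (by omega) (by omega), e2]
  · rw [netExp_shiftF7 t n (x + 3 * p) (by omega) (by omega), e3]
  · rw [netExp_shiftF7 t n (x + 4 * p) (by omega) (by omega), e4]

end MinExps

end Summit.KontsevichZagierPeriods.Zeta5Search.CellD
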